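import Summits.BirchSwinnertonDyer.Rank1Residual.X11b.AnticyclotomicSelmer
import Literature.NumberTheory.EllipticCurves.GreenbergVatsal2000.GreenbergSelmerGroups
import Literature.NumberTheory.EllipticCurves.FineSelmerTorsionCoefficientsFiniteProofs
import Literature.NumberTheory.EllipticCurves.SubgroupSelmerCocycleCriteriaProofs
import Literature.NumberTheory.EllipticCurves.GoodReductionUnramifiedProofs
import Literature.NumberTheory.GaloisRepresentations.DecompositionGroupOfCompletion
import HarnessLib

/-!
# Route UniversalToricDescent — residual Selmer comparison, the `E`-side half: if the RESIDUAL
# anticyclotomic Selmer group `R_𝔭^Σ(K_∞, E[p])` is finite and `𝔭` is finitely decomposed in `K_∞`,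
# then `Sel_𝔭^Σ(K_∞, E[p^∞])[p]` is finite

Lead prover bsd-wall-utd-p1 g6 (`--supports stmt-BirchSwinnertonDyer-20399`; PRICING-20399-ALG-HALF §2 (X) /
§8 bricks (ii)–(iv); companion of `UniversalToricDescentAcDualMuZeroCriterion` (Λ-side) and
`UniversalToricDescentResidualSelmerTransport` (transport along `E[p] ≅ E′[p]`)). Objects: Castella's
`AcSelmer.selmerAc W p κ 𝔭 Σ = Sel_𝔭^Σ(K_∞, E[p^∞])` (locally trivial at the finite `v ∉ Σ`, `v ∤ p` and at
`∞`, strict at `𝔭`) and the residual group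
`R_𝔭^Σ(K_∞, E[p]) := GreenbergVatsal2000.datumStrictSelmer (ker κ) E[p] p (AcSelmer.bdpData E[p] p 𝔭) Σ`
(unramified at the finite `v ∉ Σ`, `v ∤ p`, strict at `𝔭`).

* §1 (the easy local direction at a good place) `mem_unramifiedKer_of_torsionToPrimaryH1Sub_mem_awayKer`:
  for `v ∤ p` of good reduction and `y ∈ H¹(H, E[p])`, if the image `ι y ∈ H¹(H, E[p^∞])` is locally
  TRIVIAL at the chosen place above `v` then `y` is UNRAMIFIED there: a cocycle of `y` is `g ↦ g m − m`
  on `H ⊓ D_v` for some `m ∈ E[p^∞]`, and the inertia group `I_v = I_{𝔓₀}` fixes `m` (Silverman VII.4.1,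
  tree `smul_eq_of_mem_inertia_of_nsmul_eq_zero` at `𝔓₀ = adicCompletionPrime K v`,
  `inertia_adicCompletionPrime_eq_map_absInertia`), so the cocycle vanishes on `H ⊓ I_v`.
* §2 `forall_resOfLe_conjH1_eq_zero_of_reps`: representatives for the places of `K_∞` above a place `v`
  whose decomposition group is NOT contained in `ker κ` (finitely decomposed `v`): the local conditions
  "`res_{H ⊓ D_v}(conj_σ x) = 0`" for all `σ` follow from those for `σ = τ i`, `i < p^c` — the tree's
  `FineSelmerCoefficientMap.forall_resOfLe_conjH1_eq_zero_of_reps` with its only use of `κ.IsCyclotomic`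
  (an element of `D_v` outside `ker κ`) turned into the hypothesis; for `𝔭 ∣ p` in the anticyclotomic
  tower this is Brink's Cor. 1 (route leaf 20466, `decomp_not_le_kerSubgroup_above_of_isAnticyclotomic`).
* §3 **`finite_selmerAc_pTorsion_of_finite_residualSelmer`**: `Σ ⊇` the bad places prime to `p`, `p ∈ 𝔭`,
  `D_𝔭 ⊄ ker κ`, `R_𝔭^Σ(K_∞, E[p])` finite ⟹ `{s ∈ Sel_𝔭^Σ(K_∞, E[p^∞]) | p s = 0}` finite. Proof as the
  tree's `finite_fineSelmerInfty_pTorsion_of_finite_torsion` (Lim–Sujatha §3 / Greenberg §3): every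
  `p`-torsion Selmer class is `ι y` (`exists_torsionToPrimaryH1Sub_eq`); on `Y = ι⁻¹ Sel` the signature
  `y ↦ (res_{H⊓D_𝔭} conj_{τ i} y)_{i<p^c}` takes values in the finite local Kummer kernels
  (`finite_ker_torsionToPrimaryH1Sub`) and its kernel lies in `R_𝔭^Σ(K_∞, E[p])` (§1 at the good places,
  §2 at `𝔭`, vacuous at `Σ` and at the other places above `p`).

THEOREMS ONLY; no definition, no named fact, no `sorry`; imports no `Theses` module. BSD is not advanced by
this file. References: [LimSujatha2018] §3 (proof of Prop. 3.2); [GreenbergLNM1716] §1 p. 60, §3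
Lemmas 3.1–3.3; [GreenbergVatsal2000] §2 pp. 17, 26; [SilvermanAEC2009] VII.4.1, X.§4; [NeukirchANT1999]
II (9.6); [Brink2007] Cor. 1; [Castella2018] Def. 2.2.
-/

set_option autoImplicit false
-- `…BirchSwinnertonDyer.BirchSwinnertonDyer.Theorems…` is the problem's mandated namespace (D-0017).
set_option linter.dupNamespace false

noncomputable section

open scoped Classical

namespace Summit.BirchSwinnertonDyer.BirchSwinnertonDyer.Theorems.UniversalToricDescentResidualSelmerFinite

open NumberField IsDedekindDomain Field
open Literature.NumberTheory.EllipticCurves Literature.NumberTheory.EllipticCurves.GreenbergSelmer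
  Literature.NumberTheory.EllipticCurves.GreenbergVatsal2000
  Literature.NumberTheory.EllipticCurves.FineSelmerCoefficientMap
  Literature.NumberTheory.GaloisRepresentations WeierstrassCurve
  Summit.BirchSwinnertonDyer.Rank1Residual.X11b Summit.BirchSwinnertonDyer.Rank1Residual.X11b.AcSelmer

/-! ### §1 Locally trivial after `E[p] ↪ E[p^∞]` ⟹ unramified, at a good place `v ∤ p` -/

section Local

variable {K : Type} [Field K] [NumberField K] (W : WeierstrassCurve K) (p : ℕ) [Fact p.Prime]
  (H : Subgroup (absoluteGaloisGroup K))

omit [Fact p.Prime] in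
/-- **At a good place `v ∤ p`: if the image in `H¹(H, E[p^∞])` of `y ∈ H¹(H, E[p])` is locally trivial
at the chosen place above `v` (`awayKer`), then `y` is unramified there (`unramifiedKer`).** A cocycle
`φ` of `y` satisfies `φ(g) = g m − m` on `H ⊓ D_v` for some `m ∈ E[p^∞]` (`resOfLe_oneCocycleClass_eq_zero_iff`);
for `g` in the inertia group `I_v = I_{𝔓₀}` of the prime `𝔓₀` cut out by the chosen embedding
(`inertia_adicCompletionPrime_eq_map_absInertia`), `g m = m` because `m` is `p`-power torsion and `v ∤ p`
is good (Silverman VII.4.1, `smul_eq_of_mem_inertia_of_nsmul_eq_zero`), so `φ` vanishes on `H ⊓ I_v`.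
[cite: SilvermanAEC2009, Prop. VII.4.1(a)] [cite: GreenbergVatsal2000, §2 p. 17] -/
theorem mem_unramifiedKer_of_torsionToPrimaryH1Sub_mem_awayKer [W.IsElliptic]
    {v : HeightOneSpectrum (𝓞 K)} (hv : W.HasGoodReductionAt v) (hpv : (p : 𝓞 K) ∉ v.asIdeal)
    {y : Literature.NumberTheory.EllipticCurves.subgroupH1 H (W.geomTorsion (p : ℤ))}
    (hy : W.torsionToPrimaryH1Sub p H y ∈ awayKer H (W.geomPrimaryTorsion p) v) :
    y ∈ GreenbergVatsal2000.unramifiedKer H (W.geomTorsion (p : ℤ)) v := by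
  obtain ⟨φ, rfl⟩ := oneCocycleClass_surjective _ y
  rw [W.torsionToPrimaryH1Sub_oneCocycleClass p H, awayKer, AddMonoidHom.mem_ker,
    CocycleCriteria.resOfLe_oneCocycleClass_eq_zero_iff] at hy
  obtain ⟨m, hm⟩ := hy
  -- `m ∈ E[p^∞]` is `p^k`-torsion
  obtain ⟨k, hk⟩ : ∃ k : ℕ, p ^ k • m = 0 := by
    obtain ⟨k, hk⟩ := m.2
    exact ⟨k, Subtype.ext (by rw [AddSubgroupClass.coe_nsmul]; exact hk)⟩
  rw [GreenbergVatsal2000.unramifiedKer, AddMonoidHom.mem_ker,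
    CocycleCriteria.resH1Hom_oneCocycleClass_eq_zero_iff]
  refine ⟨0, fun x ↦ ?_⟩
  rw [smul_zero, sub_zero, AddMonoidHom.id_apply]
  -- `x ∈ H ⊓ I_v ≤ H ⊓ D_v`
  have hxH : ((x : decomp (K := K) v) : absoluteGaloisGroup K) ∈ H := ((mem_inertiaIn_iff H v _).1 x.2).1
  have hxI : ((x : decomp (K := K) v) : absoluteGaloisGroup K) ∈ inertia v :=
    ((mem_inertiaIn_iff H v _).1 x.2).2
  have hxD : ((x : decomp (K := K) v) : absoluteGaloisGroup K) ∈ decomp v := (x : decomp (K := K) v).2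
  have key := hm ⟨((x : decomp (K := K) v) : absoluteGaloisGroup K), Subgroup.mem_inf.2 ⟨hxH, hxD⟩⟩
  -- inertia fixes `m`
  have hI𝔓 : ((x : decomp (K := K) v) : absoluteGaloisGroup K) ∈
      (adicCompletionPrime K v).inertia (absoluteGaloisGroup K) := by
    rw [inertia_adicCompletionPrime_eq_map_absInertia]; exact hxI
  have hfix : ((x : decomp (K := K) v) : absoluteGaloisGroup K) • m = m := by
    apply Subtype.ext
    rw [primaryComponent.coe_smul]
    have hk' : (p ^ k : ℕ) • (m : W.geomPoints) = 0 := by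
      have := congrArg (fun z : W.geomPrimaryTorsion p ↦ (z : W.geomPoints)) hk
      simpa only [AddSubmonoidClass.coe_nsmul, ZeroMemClass.coe_zero] using this
    exact W.smul_eq_of_mem_inertia_of_nsmul_eq_zero hv (v.natCast_pow_not_mem hpv k)
      (adicCompletionPrime_mem_primesAbove K v) hI𝔓 hk'
  -- `key`: the pushed-forward cocycle vanishes at `x`; the inclusion `E[p] ↪ E[p^∞]` is injective
  rw [hfix, sub_self, contOneCocycles.push_apply] at key
  have e0 : (inertiaInToH H v x : H) = Subgroup.inclusion (inf_le_left : H ⊓ decomp v ≤ H)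
      ⟨((x : decomp (K := K) v) : absoluteGaloisGroup K), Subgroup.mem_inf.2 ⟨hxH, hxD⟩⟩ :=
    Subtype.ext rfl
  rw [e0]
  exact (injective_iff_map_eq_zero _).mp (AddSubgroup.inclusion_injective _) _ key

end Local

/-! ### §2 Representatives for the places of `K_∞` above a finitely decomposed place -/

section Reps

variable {K : Type} [Field K] [NumberField K] {p : ℕ} [Fact p.Prime] {κ : ZpExtension K p}

/-- **Representatives for the places of `K_∞` above a place `v` whose decomposition group is not
contained in `Gal(K̄/K_∞)`** (i.e. `v` is finitely decomposed in `K_∞/K`): there is `c` such that, for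
any elements `τ i` with `κ(τ i) = i` (`i < p^c`), the local conditions "`res_{H ⊓ D_v}(conj_σ x) = 0`" for
ALL `σ ∈ Γ_K` follow from those for `σ = τ i`, `i < p^c` (`κ(D_v)` is closed and contains some
`κ(δ) ≠ 1`, hence `⊇ p^c ℤ_p`; every `σ` is `δ · τ i · h` with `δ ∈ D_v`, `h ∈ ker κ`). The tree's
`forall_resOfLe_conjH1_eq_zero_of_reps` (cyclotomic `κ`, where EVERY `v` qualifies) with its one use of
cyclotomicity made the hypothesis `hv`; for `v ∣ p` in the anticyclotomic `ℤ_p`-extension of an imaginary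
quadratic field `hv` is Brink's Cor. 1 (`decomp_not_le_kerSubgroup_above_of_isAnticyclotomic`).
[cite: GreenbergLNM1716, §1 ("v is finitely decomposed in F_∞/F")] [cite: Brink2007, Cor. 1 (p. 2136)] -/
theorem forall_resOfLe_conjH1_eq_zero_of_reps {M : Type} [AddCommGroup M]
    [DistribMulAction (absoluteGaloisGroup K) M] [TopologicalSpace M] [DiscreteTopology M]
    (v : HeightOneSpectrum (𝓞 K)) (hv : ¬ (decomp v ≤ κ.kerSubgroup)) :
    ∃ c : ℕ, ∀ (τ : ℕ → absoluteGaloisGroup K),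
      (∀ i, κ (τ i) = Multiplicative.ofAdd ((i : ℕ) : ℤ_[p])) →
      ∀ x : Literature.NumberTheory.EllipticCurves.subgroupH1 κ.kerSubgroup M,
        (∀ i, i < p ^ c → resOfLe M (inf_le_left : κ.kerSubgroup ⊓ decomp v ≤ κ.kerSubgroup)
          (Literature.NumberTheory.EllipticCurves.conjH1 κ.kerSubgroup M (τ i) x) = 0) →
        ∀ σ : absoluteGaloisGroup K,
          resOfLe M (inf_le_left : κ.kerSubgroup ⊓ decomp v ≤ κ.kerSubgroup)
            (Literature.NumberTheory.EllipticCurves.conjH1 κ.kerSubgroup M σ x) = 0 := by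
  -- the closed subgroup `κ(D_v)` and a non-zero element `u` in it
  obtain ⟨δv, hδvD, hδv⟩ : ∃ δ ∈ decomp v, δ ∉ κ.kerSubgroup := Set.not_subset.mp hv
  rw [ZpExtension.mem_kerSubgroup] at hδv
  set u : ℤ_[p] := (κ δv).toAdd with hudef
  have hu0 : u ≠ 0 := fun h ↦ hδv (Multiplicative.toAdd.injective h)
  let Z : AddSubgroup ℤ_[p] :=
    AddSubgroup.toSubgroup.symm ((decomp v).map
      (κ.toContinuousMonoidHom : absoluteGaloisGroup K →* Multiplicative ℤ_[p]))
  have hZmem : ∀ y : ℤ_[p], y ∈ Z ↔ ∃ δ ∈ decomp v, κ δ = Multiplicative.ofAdd y := fun y ↦ by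
    change Multiplicative.ofAdd y ∈ (decomp v).map _ ↔ _
    rw [Subgroup.mem_map]
    rfl
  have hZclosed : IsClosed (Z : Set ℤ_[p]) := by
    have hc : IsCompact (((decomp v).map
        (κ.toContinuousMonoidHom : absoluteGaloisGroup K →* Multiplicative ℤ_[p]) :
        Subgroup (Multiplicative ℤ_[p])) : Set (Multiplicative ℤ_[p])) := by
      rw [Subgroup.coe_map]
      exact (Kobayashi2003.isCompact_decomp v).image κ.toContinuousMonoidHom.continuous
    exact hc.isClosed
  have huZ : u ∈ Z := (hZmem u).mpr ⟨δv, hδvD, rfl⟩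
  refine ⟨u.valuation, fun τ hτ x hx σ ↦ ?_⟩
  set c := u.valuation with hc
  -- write `κ σ = i + p^c z`, `i < p^c`
  set y : ℤ_[p] := (κ σ).toAdd with hy
  set i : ℕ := (PadicInt.toZModPow c y).val with hi
  have hi_lt : i < p ^ c := ZMod.val_lt _
  have hyi : y - i ∈ Ideal.span {(p : ℤ_[p]) ^ c} := by
    rw [← PadicInt.ker_toZModPow, RingHom.mem_ker, map_sub, map_natCast, hi, ZMod.natCast_zmod_val,
      sub_self]
  obtain ⟨z, hz⟩ := Ideal.mem_span_singleton.mp hyi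
  -- `p^c z ∈ κ(D_v)`: `y - i = κ δ`
  obtain ⟨δ, hδD, hδ⟩ := (hZmem _).mp (hz ▸ pow_valuation_mul_mem_of_isClosed Z hZclosed huZ hu0 z :
    y - i ∈ Z)
  -- `h = (δ τ_i)⁻¹ σ ∈ ker κ`
  have hh : (δ * τ i)⁻¹ * σ ∈ κ.kerSubgroup := by
    rw [ZpExtension.mem_kerSubgroup, map_mul, map_inv, map_mul, hδ, hτ i]
    apply Multiplicative.toAdd.injective
    rw [toAdd_mul, toAdd_inv, toAdd_mul, toAdd_ofAdd, toAdd_ofAdd, toAdd_one, ← hy]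
    ring
  have hσ : σ = δ * (τ i * ((δ * τ i)⁻¹ * σ)) := by group
  rw [hσ, Literature.NumberTheory.EllipticCurves.conjH1_mul_holds, AddMonoidHom.comp_apply,
    Literature.NumberTheory.EllipticCurves.conjH1_mul_holds, AddMonoidHom.comp_apply,
    Literature.NumberTheory.EllipticCurves.conjH1_of_mem_holds κ.kerSubgroup M hh,
    AddMonoidHom.id_apply]
  exact resOfLe_conjH1_eq_zero_of_mem κ.kerSubgroup (decomp v) hδD (hx i hi_lt)

end Reps

/-! ### §3 `R_𝔭^Σ(K_∞, E[p])` finite ⟹ `Sel_𝔭^Σ(K_∞, E[p^∞])[p]` finite -/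

section Assembly

variable {K : Type} [Field K] [NumberField K] (W : WeierstrassCurve K) [W.IsElliptic] {p : ℕ}
  [Fact p.Prime] (κ : ZpExtension K p)

/-- **`R_𝔭^Σ(K_∞, E[p])` finite ⟹ `Sel_𝔭^Σ(K_∞, E[p^∞])[p]` finite**, for an elliptic curve `E = W/K` over
a number field, ANY `ℤ_p`-extension `κ`, a place `𝔭 ∋ p` finitely decomposed in `K_∞` (`D_𝔭 ⊄ ker κ`) and
a set `Σ ∌ 𝔭` containing every bad place prime to `p`. Proof (Lim–Sujatha §3 / Greenberg §3 pattern, as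
the tree's `finite_fineSelmerInfty_pTorsion_of_finite_torsion`): every `p`-torsion class of
`Sel_𝔭^Σ(K_∞, E[p^∞])` is `ι y` for `y ∈ Y := ι⁻¹(Sel) ⊆ H¹(K_∞, E[p])` (`exists_torsionToPrimaryH1Sub_eq`);
the signature `Ψ(y) = (res_{H⊓D_𝔭} conj_{τ i} y)_{i<p^c}` takes, on `Y`, values in the finite local
Kummer kernels `ker(H¹(H ⊓ D_𝔭, E[p]) → H¹(H ⊓ D_𝔭, E[p^∞]))` (`finite_ker_torsionToPrimaryH1Sub`), and its
kernel on `Y` lies in `R_𝔭^Σ(K_∞, E[p])`: at the good places `v ∉ Σ`, `v ∤ p` by §1 (locally trivial ⟹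
unramified), at `𝔭` by §2 (all conjugates from the `p^c` representatives), no condition at `Σ` and at
the other places above `p`. [cite: LimSujatha2018, §3 (proof of Prop. 3.2)] [cite: GreenbergLNM1716, §3 (Lemmas 3.1–3.3)] -/
theorem finite_selmerAc_pTorsion_of_finite_residualSelmer
    {𝔭 : HeightOneSpectrum (𝓞 K)} (h𝔭 : ((p : ℕ) : 𝓞 K) ∈ 𝔭.asIdeal)
    (h𝔭dec : ¬ (decomp 𝔭 ≤ κ.kerSubgroup)) {S : Set (HeightOneSpectrum (𝓞 K))}
    (hS : ∀ v : HeightOneSpectrum (𝓞 K), v ∉ S → ((p : ℕ) : 𝓞 K) ∉ v.asIdeal → W.HasGoodReductionAt v)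
    (hfin : (datumStrictSelmer κ.kerSubgroup (W.geomTorsion (p : ℤ)) p
        (AcSelmer.bdpData _ p 𝔭) S :
        Set (Literature.NumberTheory.EllipticCurves.subgroupH1 κ.kerSubgroup
          (W.geomTorsion (p : ℤ)))).Finite) :
    Set.Finite {s : selmerAc W p κ 𝔭 S | p • s = 0} := by
  have hpr : p.Prime := Fact.out
  -- notation
  let H := κ.kerSubgroup
  let Mp : Type := ↥(W.geomTorsion (p : ℤ))
  let ι : Literature.NumberTheory.EllipticCurves.subgroupH1 H Mp →+ W.subgroupH1 p H :=
    W.torsionToPrimaryH1Sub p H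
  -- representatives at `𝔭`
  obtain ⟨c, hc⟩ := forall_resOfLe_conjH1_eq_zero_of_reps (M := Mp) (κ := κ) 𝔭 h𝔭dec
  have hτex : ∀ i : ℕ, ∃ τ : absoluteGaloisGroup K, κ τ = Multiplicative.ofAdd ((i : ℕ) : ℤ_[p]) :=
    fun i ↦ κ.surjective _
  choose τ hτ using hτex
  -- the signature map `Ψ` (restrictions at `𝔭` of the `p^c` conjugates)
  let resp : Literature.NumberTheory.EllipticCurves.subgroupH1 H Mp →+
      Literature.NumberTheory.EllipticCurves.subgroupH1 (H ⊓ decomp 𝔭) Mp :=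
    resOfLe Mp (inf_le_left : H ⊓ decomp 𝔭 ≤ H)
  let Ψ : Literature.NumberTheory.EllipticCurves.subgroupH1 H Mp →+
      (Fin (p ^ c) → Literature.NumberTheory.EllipticCurves.subgroupH1 (H ⊓ decomp 𝔭) Mp) :=
    { toFun := fun x i ↦ resp (Literature.NumberTheory.EllipticCurves.conjH1 H Mp (τ i) x)
      map_zero' := by ext i; simp
      map_add' := fun x y ↦ by ext i; simp }
  -- `Y = ι⁻¹ Sel_𝔭^Σ(K_∞, E[p^∞])`
  let Y : AddSubgroup (Literature.NumberTheory.EllipticCurves.subgroupH1 H Mp) :=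
    (selmerAc W p κ 𝔭 S).comap ι
  have hYmem : ∀ x, x ∈ Y ↔ ι x ∈ selmerAc W p κ 𝔭 S := fun x ↦ Iff.rfl
  -- (a) on `Y`, `Ψ` takes values in the finite local Kummer kernels
  have hΨker : ∀ x ∈ Y, ∀ i : Fin (p ^ c),
      Ψ x i ∈ (W.torsionToPrimaryH1Sub p (H ⊓ decomp 𝔭)).ker := by
    intro x hx i
    rw [AddMonoidHom.mem_ker]
    change W.torsionToPrimaryH1Sub p _
      (resp (Literature.NumberTheory.EllipticCurves.conjH1 H Mp (τ i) x)) = 0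
    rw [← resOfLe_torsionToPrimaryH1Sub, ← WeierstrassCurve.conjH1_torsionToPrimaryH1Sub]
    have hsel := ((mem_selmerOver_iff _).mp ((hYmem x).mp hx)).2.2 (τ i)
    rw [← mem_strictKer_fineLocalDatum_iff]
    exact hsel
  -- (b) the kernel of `Ψ` on `Y` lies in the residual group
  have hΨzero : ∀ x ∈ Y, Ψ x = 0 →
      x ∈ datumStrictSelmer H Mp p (AcSelmer.bdpData _ p 𝔭) S := by
    intro x hx hΨ
    have hxS := (mem_selmerOver_iff _).mp ((hYmem x).mp hx)
    rw [mem_datumStrictSelmer_iff, mem_unramifiedOutside_iff]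
    refine ⟨fun v hvS hpv σ ↦ ?_, fun v hv σ ↦ ?_⟩
    · -- good place `v ∤ p` outside `Σ`: locally trivial ⟹ unramified (§1)
      have hpv' : (p : 𝓞 K) ∉ v.asIdeal := hpv
      refine mem_unramifiedKer_of_torsionToPrimaryH1Sub_mem_awayKer W p H (hS v hvS hpv) hpv' ?_
      rw [← WeierstrassCurve.conjH1_torsionToPrimaryH1Sub]
      exact hxS.1 v hpv hvS σ
    · by_cases hv𝔭 : v = 𝔭
      · -- at `𝔭`: all conjugates from the representatives (§2)
        subst hv𝔭
        rw [AcSelmer.bdpData_self p v hv,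
          show AcSelmer.strictDatum Mp v = fineLocalDatum Mp v from rfl,
          mem_strictKer_fineLocalDatum_iff]
        refine hc τ hτ x (fun i hi ↦ ?_) σ
        exact congrFun hΨ ⟨i, hi⟩
      · rw [AcSelmer.bdpData_of_ne p 𝔭 hv hv𝔭, AcSelmer.strictKer_relaxedDatum_eq_top]
        exact AddSubgroup.mem_top _
  -- (c) `Y` is finite
  have hYfin : (Y : Set (Literature.NumberTheory.EllipticCurves.subgroupH1 H Mp)).Finite := by
    let g : Y →+ (Fin (p ^ c) → Literature.NumberTheory.EllipticCurves.subgroupH1 (H ⊓ decomp 𝔭) Mp) :=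
      Ψ.comp Y.subtype
    have hgker : ((g.ker : AddSubgroup Y) : Set Y).Finite := by
      have hsub : ((g.ker : AddSubgroup Y) : Set Y) ⊆
          (fun r : Y ↦ (r : Literature.NumberTheory.EllipticCurves.subgroupH1 H Mp)) ⁻¹'
            (datumStrictSelmer H Mp p (AcSelmer.bdpData _ p 𝔭) S :
              Set (Literature.NumberTheory.EllipticCurves.subgroupH1 H Mp)) := by
        intro r hr
        exact hΨzero r r.2 ((AddMonoidHom.mem_ker).mp hr)
      exact (hfin.preimage Subtype.val_injective.injOn).subset hsub
    let T : Set (Fin (p ^ c) → Literature.NumberTheory.EllipticCurves.subgroupH1 (H ⊓ decomp 𝔭) Mp) :=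
      Set.pi Set.univ fun _ ↦ ((W.torsionToPrimaryH1Sub p (H ⊓ decomp 𝔭)).ker : Set _)
    have hTfin : T.Finite := by
      refine Set.Finite.pi fun _ ↦ ?_
      exact W.finite_ker_torsionToPrimaryH1Sub p (H := H ⊓ decomp 𝔭) W.zsmul_geomPoints_surjective_holds
    have huniv : (g ⁻¹' T) = Set.univ := by
      ext r
      simp only [Set.mem_preimage, Set.mem_univ, iff_true, T, Set.mem_univ_pi]
      intro i
      exact hΨker r r.2 i
    have hYuniv : (Set.univ : Set Y).Finite := by
      rw [← huniv]
      exact AddMonoidHom.finite_preimage_of_finite_ker g hgker hTfin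
    have : (Y : Set (Literature.NumberTheory.EllipticCurves.subgroupH1 H Mp)) =
        (fun r : Y ↦ (r : Literature.NumberTheory.EllipticCurves.subgroupH1 H Mp)) '' Set.univ := by
      ext x
      simp only [SetLike.mem_coe, Set.image_univ, Set.mem_range, Subtype.exists, exists_prop,
        exists_eq_right]
    rw [this]
    exact hYuniv.image _
  -- (d) every `p`-torsion Selmer class is `ι x` with `x ∈ Y`
  have hsub : {s : selmerAc W p κ 𝔭 S | p • s = 0} ⊆
      (fun s : selmerAc W p κ 𝔭 S ↦ (s : W.subgroupH1 p H)) ⁻¹'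
        (ι '' (Y : Set (Literature.NumberTheory.EllipticCurves.subgroupH1 H Mp))) := by
    intro s hs
    have hs' : p • (s : W.subgroupH1 p H) = 0 := by
      rw [← AddSubgroupClass.coe_nsmul, show p • s = 0 from hs]; rfl
    obtain ⟨x, hx⟩ := W.exists_torsionToPrimaryH1Sub_eq p W.zsmul_geomPoints_surjective_holds hs'
    refine ⟨x, ?_, hx⟩
    change ι x ∈ selmerAc W p κ 𝔭 S
    rw [show ι x = (s : W.subgroupH1 p H) from hx]
    exact s.2
  exact ((hYfin.image ι).preimage Subtype.val_injective.injOn).subset hsub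

end Assembly

end Summit.BirchSwinnertonDyer.BirchSwinnertonDyer.Theorems.UniversalToricDescentResidualSelmerFinite

end
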